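import Literature.MathematicalPhysics.QuantumFieldTheory.Balaban1983to89.B3Sect3VectorSelfEnergy
import Literature.MathematicalPhysics.QuantumFieldTheory.Balaban1983to89.B3Ineq314Cubes

/-!
# `Balaban1983to89.B3Ineq326LastBracket` — T. Bałaban, *(Higgs)₂,₃ quantum fields in a finite volume. III. Renormalization*,
# Commun. Math. Phys. **88** (1983) 411–445 [Balaban1983Higgs3], p. 440 [PDF 30]: the sentence after **(3.26)** on its LAST CURLY
# BRACKET — *"The expressions in the last curly bracket above are the generalized expressions of the same form as in (3.11), they
# have positive degree −d+3+α and can be analyzed as in (3.13), (3.14), and Proposition 2.2 can be applied."* — the (3.13)/(3.14)-type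
# estimates of that bracket PROVED on the TORUS objects of record (r15's `B3Sect3VectorSelfEnergy.curly2`), in the pointwise and in the
# printed cube-localized forms, plus (3.26) on the torus with the printed Taylor data (FILE 1 of 2; FILE 2 `B3Ineq326LastBracketLattice`
# = the same on the print's carrier `ηℤ^{d+1}` for p39's `B3Eq326ZeroLattice.curly2Z`, kernel hypotheses discharged for the pieces of `G_k(0)`)

statement-level skeleton of published theorems with citation tags; proofs where landed; nothing here is a claim about the Yang–Mills mass gap

PDF held: `paper:balaban1983-higgs-2-3-quantum-fields-finite-volume` (journal page = PDF page + 410); p. 440 [PDF 30] read first-hand on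
the ×2 render `run/shared/lean/pub/pub-balaban/b2b-balaban-ref1/pages/1983-cmp88-higgs23-III/1983-cmp88-higgs23-III-p030-x2.png` (the
text layer garbles (3.26)); p. 436 [PDF 26] ((3.13)/(3.14)) via p26's transcript in `B3Ineq313Lattice`.

CITATION HEADER (lean-in-tree rule).  Part of the lit-balaban TYPED SKELETON (HOME `run/shared/lean/pub/lit-balaban/`), PHASE 2, seat p32
gen 30 (unit `lit-balaban-p32`; free-target protocol G.5-34(d); TAKING line HOME/STATUS.md 2026-08-23T01:59:30Z): member **(δ)** of the
fold owner r15's head residual of SKELETON row **B3.Eq3.25-3.32** (`lit-balaban-r15/B3-CLOSURE.md` v1.21 §5 item 15, HOME/STATUS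
2026-08-23T01:36Z: *"(δ) p. 440's sentence on the LAST curly bracket («generalized expressions of the same form as in (3.11), positive
degree −d+3+α, analyzed as in (3.13), (3.14), Prop. 2.2») — a (3.13)/(3.14)-type bound for the |x′−x|^{1+α}-weighted two-propagator
kernel with the Hölder quotient of ∂^ηg′A′"*).  The owner's question of 01:36Z whether p26's `B3Ineq313Lattice.term312Z`/
`abs_term312Z_le_local` instantiate this bracket is answered NO here: `term312Z` carries the scalar kernel `coeff39Z`
(`Σ_ν(∂_νG_{(j)}∂*_ν)(x,x′)·g(x)G_{(j′)}(x,x′)g′(x′)`) and the remainder of `φ′`, whereas the (3.26) bracket carries the kernels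
`−(G_{(j)}∂*_{μ′})(x,x′)(G_{(j′)}∂*_μ)(x′,x) + G_{(j)}(x,x′)(∂_{μ′}G_{(j′)}∂*_μ)(x′,x)` (r15's `kerC = −kerA + kerB`) and the remainder of
the function `g′A′_{μ′}` (the localization `g′` INSIDE the differentiated leg), with `tr q²` a scalar — hence this TWIN of p20's
`B3Ineq313Pointwise`/`B3Ineq314Local`/`B3Ineq314Cubes` §3 pattern for r15's (3.26) objects, proved by the same mechanism (p20's
`exp_mul_weight_le`/`exp_mul_weight_le_local`/`sum_sum_le_cubes`/`norm_remFwd_le` — all BY NAME; nothing of another seat is modified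
or restated).  The `ηℤ^{d+1}` half ((δ) on the print's carrier, for p39 g17's `B3Eq326ZeroLattice` vocabulary filed as p349037 while this
file was written — same kernels `kerCZ`/`curly2Z`, so NO second vocabulary is declared by this seat) is FILE 2 `B3Ineq326LastBracketLattice`.

THE PRINTED TEXT (verbatim from the render, p. 440; `d` = the print's dimension).  The last curly bracket of (3.26):
*"+ { Σ_{x,x′} η^{2d} Σ_{μ,μ′=1}^d g(x)A_μ(x) tr q²[ −(G^η_{(j)}(0)∂^{η*}_{μ′})(x,x′)(G^η_{(j′)}(0)∂^{η*}_μ)(x′,x)|x′−x|^{1+α}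
+ G^η_{(j)}(0;x,x′)(∂^η_{μ′}G^η_{(j′)}(0)∂^{η*}_μ)(x′,x)|x′−x|^{1+α} ] · Σ_{b⊂Γ_{x,x′}} (η|b_−−x|^α/|x′−x|^{1+α})
((∂^ηg′A′_{μ′})(b) − (∂^ηg′A′_{μ′})((b)_x))/|b_−−x|^α },  (3.26)  where A, A′ are external vector field legs. The expressions in the last
curly bracket above are the generalized expressions of the same form as in (3.11), they have positive degree −d+3+α and can be analyzed as
in (3.13), (3.14), and Proposition 2.2 can be applied."*  ((3.13)/(3.14), p. 436, verbatim in `B3Ineq313Lattice`'s module docstring.)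

WHAT IS REPRODUCED, and how (kind «one-scale analytic inequality, ≤ 1 printed page», G.2(c); every theorem proved).
* §1 ON THE TORUS `T^{(j)}_η`, for r15's objects BY NAME (`curly2 η τ Gj Gj' g A R = pairSum η (kerC η τ Gj Gj') g A R`, `kerA`, `kerB`,
  `kerC`, `dAdjKernel`, `d2Kernel`): `abs_kerC_le` (the combined kernel under the (2.10)-type bounds on `G_{(j)}∂*`, `G_{(j′)}∂*`,
  `G_{(j)}`, `∂G_{(j′)}∂*`: `|kerC| ≤ |τ|(C₁C₂s^{1−d}s′^{1−d} + C₃C₄s^{2−d}s′^{−d})e^{−δu/s}e^{−δu/s′}`, `u = η|x−x′|₁`);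
  **`abs_curly2_le`** = the (3.13)-type bound: with `|g| ≤ 1` and the remainder bound `|R_{μ′}(x,x′)| ≤ H·u·u^α` (the shape delivered by
  p20's `B3Taylor310Remainder.norm_remFwd_le` for the forward Taylor remainder of `g′A′_{μ′}` under `HolderDeriv`, or by FILE A's
  `norm_rem_le`), `|curly2| ≤ d|τ|(C₁C₂s^{1−d}s′^{1−d} + C₃C₄s^{2−d}s′^{−d})H(2/δ+8/δ²)(m·m^α)Σ_{x,x′}η^{2d}(Σ_μ|A_μ(x)|)e^{−½δu/s}e^{−½δu/s′}`,
  `m = min(s,s′)`; **`abs_curly2_le_local`** = the (3.14)-type bound (remainder bound localized around the second leg `x″` of the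
  propagator carrying `A′`, `max(s,s′) ≤ s″`: the extra factor `e^{−½δη|x−x″|₁/s″}`); **`abs_curly2_le_cubes`** /
  **`abs_curly2_le_local_cubes`** = the printed cube-localized forms (p20's `sum_sum_le_cubes`); **`eq326_taylorFwd`** = r15's `eq326`
  with the printed Taylor data supplied by p20's `B3Taylor310Remainder.taylor310_fwd` (displacement `disp`, derivative `pdiff`, remainder
  `remFwd` of `g′A′_{μ′}`) — (3.26) on the torus with NO hypothesis; `abs_curly2_remFwd_le` = the bound for that remainder under p20's
  `HolderDeriv` (`norm_remFwd_le`).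
HONEST SCOPE / DECLARED DIVERGENCES (F7).  (i) As p20's torus files: zero background, `|x − x′|` = `η·Site.tdist` (`ℓ¹`, lattice steps;
`Setup` DIVERGENCE F2), `|g| ≤ 1` a hypothesis, `tr q²` an arbitrary real `τ` (r15's convention), the vector legs `A`, `A′` real-valued per
component (r15's `VecField P j ℝ`).  (ii) The remainder `R` is DATA with a bound hypothesis, exactly as r15's `eq326` takes it (T3 of
`B3Sect3VectorSelfEnergy`: the printed `|x′−x|^{1+α}` inserted and divided is not performed); the specialization `abs_curly2_remFwd_le` takes the
forward Taylor remainder of `g′A′_{μ′}` under a GLOBAL Hölder hypothesis on `∂^η(g′A′_{μ′})` — the product-rule step splitting that hypothesis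
into one on `g′` (p. 420 smooth localizations) and one on `A′` is NOT performed here.  (iii) The four (2.10)-type kernel bounds are HYPOTHESES
in this file (rows B3.Eq2.10/2.11; they are DISCHARGED for the pieces of `G_k(0)` on `ηℤ^{d+1}` in FILE 2).  (iv) Constants explicit; `d ≥ 1`
arbitrary (`P.d`); cube sides arbitrary `M ≥ 1` (print: `M = L^{j₁}`).  (v) The degree count «positive degree −d+3+α» and «Proposition 2.2
can be applied» are NOT formalized here (rows B3.Eq2.13-2.14 / B3.Prop2.2); this file is the analytic (3.13)/(3.14) step only.  Theorems only
(no definition, no Literature fact minted, no `sorry`); standard axioms.  Value = one located member of row B3.Eq3.25-3.32, NOT summit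
progress.
Unit `lit-balaban-p32` (Phase-2 proof seat p32, gen 30); HOME `run/shared/lean/pub/lit-balaban/` (row B3.Eq3.25-3.32, FILED.md, STATUS.md),
2026-08-23.
-/

open scoped BigOperators

namespace Literature.MathematicalPhysics.QuantumFieldTheory.Balaban1983to89.B3Ineq326LastBracket

open LatticeFieldCalculus B3Sect3ScalarSelfEnergy B3Sect3VectorSelfEnergy
open B3Ineq313Pointwise (exp_mul_weight_le)
open B3Ineq314Local (exp_mul_weight_le_local)
open B3Ineq314Cubes (supOn le_supOn supOn_le supOn_nonneg)

noncomputable section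

/-! ## §0 Elementary kernel lemmas -/

section Elementary

/-- kernel: a constant dominating an absolute value through two positive factors is nonnegative. [folklore] -/
private theorem nonneg_of_abs_le_mul_mul {v C p e : ℝ} (h : |v| ≤ C * p * e) (hp : 0 < p) (he : 0 < e) : 0 ≤ C :=
  nonneg_of_mul_nonneg_left (nonneg_of_mul_nonneg_left ((abs_nonneg v).trans h) he) hp

/-- kernel: a double sum over the axes of terms bounded by `a μ · B` (`B` independent of the axes) is at most `(Σ_μ a μ)·(n·B)`.
[folklore] -/
private theorem abs_sum_sum_le_sum_mul {n : ℕ} (t : Fin n → Fin n → ℝ) (a : Fin n → ℝ) (B : ℝ)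
    (h : ∀ μ μ', |t μ μ'| ≤ a μ * B) :
    |∑ μ : Fin n, ∑ μ' : Fin n, t μ μ'| ≤ (∑ μ : Fin n, a μ) * ((n : ℝ) * B) := by
  calc |∑ μ : Fin n, ∑ μ' : Fin n, t μ μ'| ≤ ∑ μ : Fin n, |∑ μ' : Fin n, t μ μ'| := Finset.abs_sum_le_sum_abs _ _
    _ ≤ ∑ μ : Fin n, ∑ μ' : Fin n, |t μ μ'| := Finset.sum_le_sum fun μ _ => Finset.abs_sum_le_sum_abs _ _
    _ ≤ ∑ μ : Fin n, ∑ _μ' : Fin n, a μ * B := Finset.sum_le_sum fun μ _ => Finset.sum_le_sum fun μ' _ => h μ μ'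
    _ = (∑ μ : Fin n, a μ) * ((n : ℝ) * B) := by
        simp only [Finset.sum_const, Finset.card_univ, Fintype.card_fin, nsmul_eq_mul, Finset.sum_mul]
        exact Finset.sum_congr rfl fun μ _ => by ring

end Elementary

/-! ## §1 The last curly bracket of (3.26) on the torus: the (3.13)/(3.14)-type bounds for r15's `curly2` -/

section Torus

variable {P : Params} {j : ℕ}

/-- kernel: the `ℓ¹` torus distance is symmetric. [folklore] -/
private theorem tdist_comm (x y : Site P j) : Site.tdist x y = Site.tdist y x := by
  unfold Site.tdist
  exact Finset.sum_congr rfl fun μ _ => min_comm _ _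

/-- **The combined kernel of the curly brackets of (3.26) under (2.10)-type kernel bounds** (p. 440; the two products of the bracket:
`(G_{(j)}∂*_{μ′})(x,x′)·(G_{(j′)}∂*_μ)(x′,x)` — one difference on each propagator, *"for each differentiation an additional factor
(L^jη)^{−1}"* (2.10) — and `G_{(j)}(x,x′)·(∂_{μ′}G_{(j′)}∂*_μ)(x′,x)` — two differences on the second): for r15's `kerC = −kerA + kerB`,
`|kerC_{μμ′}(x,x′)| ≤ |τ|(C₁s^{1−d}·C₂s′^{1−d} + C₃s^{2−d}·C₄s′^{−d})e^{−δu/s}e^{−δu/s′}`, `u = η|x − x′|₁`, `τ` = tr q².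
[cite: Balaban1983Higgs3, (3.26) p.440] -/
theorem abs_kerC_le {η τ C₁ C₂ C₃ C₄ δ s s' : ℝ} {Gj Gj' : Kernel P j}
    (hA : ∀ (μ' : Fin P.d) (y y' : Site P j),
      |dAdjKernel η⁻¹ μ' Gj y y'| ≤ C₁ * s ^ (1 - (P.d : ℝ)) * Real.exp (-(δ * s⁻¹ * (η * Site.tdist y y'))))
    (hA' : ∀ (μ : Fin P.d) (y y' : Site P j),
      |dAdjKernel η⁻¹ μ Gj' y y'| ≤ C₂ * s' ^ (1 - (P.d : ℝ)) * Real.exp (-(δ * s'⁻¹ * (η * Site.tdist y y'))))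
    (hB : ∀ y y' : Site P j, |Gj y y'| ≤ C₃ * s ^ (2 - (P.d : ℝ)) * Real.exp (-(δ * s⁻¹ * (η * Site.tdist y y'))))
    (hB' : ∀ (μ' μ : Fin P.d) (y y' : Site P j),
      |d2Kernel η⁻¹ μ' μ Gj' y y'| ≤ C₄ * s' ^ (-(P.d : ℝ)) * Real.exp (-(δ * s'⁻¹ * (η * Site.tdist y y'))))
    (μ μ' : Fin P.d) (x x' : Site P j) :
    |kerC η τ Gj Gj' μ μ' x x'| ≤
      |τ| * (C₁ * s ^ (1 - (P.d : ℝ)) * (C₂ * s' ^ (1 - (P.d : ℝ))) + C₃ * s ^ (2 - (P.d : ℝ)) * (C₄ * s' ^ (-(P.d : ℝ)))) *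
        (Real.exp (-(δ * s⁻¹ * (η * Site.tdist x x'))) * Real.exp (-(δ * s'⁻¹ * (η * Site.tdist x x')))) := by
  set u : ℝ := η * Site.tdist x x' with hu
  have hux : η * (Site.tdist x' x : ℝ) = u := by rw [tdist_comm x' x]
  have h1 := hA μ' x x'
  have h2 := hA' μ x' x
  have h3 := hB x x'
  have h4 := hB' μ' μ x' x
  rw [hux] at h2 h4
  have e1 : 0 ≤ C₁ * s ^ (1 - (P.d : ℝ)) * Real.exp (-(δ * s⁻¹ * u)) := (abs_nonneg _).trans h1
  have e3 : 0 ≤ C₃ * s ^ (2 - (P.d : ℝ)) * Real.exp (-(δ * s⁻¹ * u)) := (abs_nonneg _).trans h3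
  have hAk : |kerA η τ Gj Gj' μ μ' x x'| ≤ |τ| * ((C₁ * s ^ (1 - (P.d : ℝ)) * Real.exp (-(δ * s⁻¹ * u))) *
      (C₂ * s' ^ (1 - (P.d : ℝ)) * Real.exp (-(δ * s'⁻¹ * u)))) := by
    unfold kerA
    rw [abs_mul, abs_mul]
    exact mul_le_mul_of_nonneg_left (mul_le_mul h1 h2 (abs_nonneg _) e1) (abs_nonneg _)
  have hBk : |kerB η τ Gj Gj' μ μ' x x'| ≤ |τ| * ((C₃ * s ^ (2 - (P.d : ℝ)) * Real.exp (-(δ * s⁻¹ * u))) *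
      (C₄ * s' ^ (-(P.d : ℝ)) * Real.exp (-(δ * s'⁻¹ * u)))) := by
    unfold kerB
    rw [abs_mul, abs_mul]
    exact mul_le_mul_of_nonneg_left (mul_le_mul h3 h4 (abs_nonneg _) e3) (abs_nonneg _)
  unfold kerC
  calc |-kerA η τ Gj Gj' μ μ' x x' + kerB η τ Gj Gj' μ μ' x x'|
      ≤ |-kerA η τ Gj Gj' μ μ' x x'| + |kerB η τ Gj Gj' μ μ' x x'| := abs_add_le _ _
    _ = |kerA η τ Gj Gj' μ μ' x x'| + |kerB η τ Gj Gj' μ μ' x x'| := by rw [abs_neg]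
    _ ≤ |τ| * ((C₁ * s ^ (1 - (P.d : ℝ)) * Real.exp (-(δ * s⁻¹ * u))) * (C₂ * s' ^ (1 - (P.d : ℝ)) * Real.exp (-(δ * s'⁻¹ * u))))
        + |τ| * ((C₃ * s ^ (2 - (P.d : ℝ)) * Real.exp (-(δ * s⁻¹ * u))) * (C₄ * s' ^ (-(P.d : ℝ)) * Real.exp (-(δ * s'⁻¹ * u)))) :=
        add_le_add hAk hBk
    _ = _ := by ring

/-- kernel: the per-pair bound behind `abs_curly2_le` — for fixed `x, x′` the axis double sum of the integrand of `pairSum` with the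
kernel `kerC` and a remainder `|R_{μ′}(x,x′)| ≤ ρ(x,x′)` is at most `η^{2d}(Σ_μ|A_μ(x)|)·d·[|τ|K·e·e′]·ρ`. [cite: Balaban1983Higgs3, (3.26) p.440] -/
private theorem abs_pairTerm_le {η τ K : ℝ} {Gj Gj' : Kernel P j} {g : SiteField P j ℝ} (hg : ∀ x, |g x| ≤ 1)
    {A : VecField P j ℝ} {R : Fin P.d → Site P j → Site P j → ℝ} {E ρ : Site P j → Site P j → ℝ}
    (hK : ∀ (μ μ' : Fin P.d) (x x' : Site P j), |kerC η τ Gj Gj' μ μ' x x'| ≤ K * E x x') (hK0 : 0 ≤ K)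
    (hE : ∀ x x', 0 ≤ E x x') (hR : ∀ (μ' : Fin P.d) (x x' : Site P j), |R μ' x x'| ≤ ρ x x') (hη : 0 ≤ η)
    (x x' : Site P j) :
    |η ^ (2 * P.d) * ∑ μ : Fin P.d, ∑ μ' : Fin P.d, g x * A ⟨x, μ⟩ * kerC η τ Gj Gj' μ μ' x x' * R μ' x x'| ≤
      η ^ (2 * P.d) * ((∑ μ : Fin P.d, |A ⟨x, μ⟩|) * ((P.d : ℝ) * (K * E x x' * ρ x x'))) := by
  rw [abs_mul, abs_of_nonneg (pow_nonneg hη _)]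
  refine mul_le_mul_of_nonneg_left ?_ (pow_nonneg hη _)
  refine abs_sum_sum_le_sum_mul _ (fun μ => |A ⟨x, μ⟩|) (K * E x x' * ρ x x') fun μ μ' => ?_
  rw [abs_mul, abs_mul, abs_mul]
  have h1 : |g x| * |A ⟨x, μ⟩| ≤ 1 * |A ⟨x, μ⟩| := mul_le_mul_of_nonneg_right (hg x) (abs_nonneg _)
  have h2 : |g x| * |A ⟨x, μ⟩| * |kerC η τ Gj Gj' μ μ' x x'| ≤ 1 * |A ⟨x, μ⟩| * (K * E x x') :=
    mul_le_mul h1 (hK μ μ' x x') (abs_nonneg _) (mul_nonneg zero_le_one (abs_nonneg _))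
  calc |g x| * |A ⟨x, μ⟩| * |kerC η τ Gj Gj' μ μ' x x'| * |R μ' x x'|
      ≤ 1 * |A ⟨x, μ⟩| * (K * E x x') * ρ x x' :=
        mul_le_mul h2 (hR μ' x x') (abs_nonneg _)
          (mul_nonneg (mul_nonneg zero_le_one (abs_nonneg _)) (mul_nonneg hK0 (hE x x')))
    _ = |A ⟨x, μ⟩| * (K * E x x' * ρ x x') := by ring

/-- kernel: the summation step — a termwise bound `|t(x,x′)| ≤ K·b(x,x′)` sums to `|Σt| ≤ K·Σb`. [folklore] -/
private theorem abs_sum_sum_le_of_termwise {t b : Site P j → Site P j → ℝ} {K : ℝ}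
    (h : ∀ x x', |t x x'| ≤ K * b x x') :
    |∑ x : Site P j, ∑ x' : Site P j, t x x'| ≤ K * ∑ x : Site P j, ∑ x' : Site P j, b x x' := by
  calc |∑ x : Site P j, ∑ x' : Site P j, t x x'| ≤ ∑ x : Site P j, |∑ x' : Site P j, t x x'| := Finset.abs_sum_le_sum_abs _ _
    _ ≤ ∑ x : Site P j, ∑ x' : Site P j, |t x x'| := Finset.sum_le_sum fun x _ => Finset.abs_sum_le_sum_abs _ _
    _ ≤ ∑ x : Site P j, ∑ x' : Site P j, K * b x x' := Finset.sum_le_sum fun x _ => Finset.sum_le_sum fun x' _ => h x x'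
    _ = K * ∑ x : Site P j, ∑ x' : Site P j, b x x' := by
        rw [Finset.mul_sum]
        exact Finset.sum_congr rfl fun x _ => by rw [Finset.mul_sum]

/-- **The last curly bracket of (3.26), the (3.13)-type bound on the torus** (p. 440 *"analyzed as in (3.13)"*, p. 436 (3.13)), PROVED
for r15's `curly2 η τ Gj Gj' g A R`: under the (2.10)-type bounds on the four kernels `G_{(j)}∂*_{μ′}`, `G_{(j′)}∂*_μ`, `G_{(j)}`,
`∂_{μ′}G_{(j′)}∂*_μ` at the scales `s = L^jη`, `s′ = L^{j′}η`, `|g| ≤ 1`, and the remainder bound `|R_{μ′}(x,x′)| ≤ H·u·u^α` (`u = η|x−x′|₁`,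
`0 ≤ α ≤ 1` — *"a differentiation of the order 1 + α"* acting on the leg `g′A′_{μ′}`),
`|curly2| ≤ d·|τ|·(C₁C₂s^{1−d}s′^{1−d} + C₃C₄s^{2−d}s′^{−d})·H·(2/δ + 8/δ²)·(m·m^α)·Σ_{x,x′}η^{2d}(Σ_μ|A_μ(x)|)e^{−½δu/s}e^{−½δu/s′}`,
`m = min(s,s′) = L^{j₁}η` — the printed mechanism of (3.13)/(3.14): the weight `|x′−x|^{1+α}` costs `(L^{j₁}η)^{1+α}` and *"half of the
exponential factor with index j₁"* (p20's `exp_mul_weight_le`). [cite: Balaban1983Higgs3, (3.26) p.440] -/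
theorem abs_curly2_le (η : ℝ) (hη : 0 < η) {α H τ C₁ C₂ C₃ C₄ δ s s' : ℝ} (hα0 : 0 ≤ α) (hα1 : α ≤ 1) (hH : 0 ≤ H)
    (hδ : 0 < δ) (hs : 0 < s) (hs' : 0 < s') (Gj Gj' : Kernel P j) (g : SiteField P j ℝ) (hg : ∀ x, |g x| ≤ 1)
    (A : VecField P j ℝ)
    (hA : ∀ (μ' : Fin P.d) (y y' : Site P j),
      |dAdjKernel η⁻¹ μ' Gj y y'| ≤ C₁ * s ^ (1 - (P.d : ℝ)) * Real.exp (-(δ * s⁻¹ * (η * Site.tdist y y'))))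
    (hA' : ∀ (μ : Fin P.d) (y y' : Site P j),
      |dAdjKernel η⁻¹ μ Gj' y y'| ≤ C₂ * s' ^ (1 - (P.d : ℝ)) * Real.exp (-(δ * s'⁻¹ * (η * Site.tdist y y'))))
    (hB : ∀ y y' : Site P j, |Gj y y'| ≤ C₃ * s ^ (2 - (P.d : ℝ)) * Real.exp (-(δ * s⁻¹ * (η * Site.tdist y y'))))
    (hB' : ∀ (μ' μ : Fin P.d) (y y' : Site P j),
      |d2Kernel η⁻¹ μ' μ Gj' y y'| ≤ C₄ * s' ^ (-(P.d : ℝ)) * Real.exp (-(δ * s'⁻¹ * (η * Site.tdist y y'))))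
    (R : Fin P.d → Site P j → Site P j → ℝ)
    (hR : ∀ (μ' : Fin P.d) (x x' : Site P j), |R μ' x x'| ≤ H * (η * Site.tdist x x') * (η * Site.tdist x x') ^ α) :
    |curly2 η τ Gj Gj' g A R| ≤
      (P.d : ℝ) * |τ| * (C₁ * C₂ * (s ^ (1 - (P.d : ℝ)) * s' ^ (1 - (P.d : ℝ))) + C₃ * C₄ * (s ^ (2 - (P.d : ℝ)) * s' ^ (-(P.d : ℝ))))
        * H * (2 / δ + 8 / δ ^ 2) * (min s s' * (min s s') ^ α) *
        ∑ x : Site P j, ∑ x' : Site P j, η ^ (2 * P.d) *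
          ((∑ μ : Fin P.d, |A ⟨x, μ⟩|) *
            (Real.exp (-(δ / 2 * s⁻¹ * (η * Site.tdist x x'))) * Real.exp (-(δ / 2 * s'⁻¹ * (η * Site.tdist x x'))))) := by
  have hC₁ : 0 ≤ C₁ := nonneg_of_abs_le_mul_mul (hA ⟨0, P.hd⟩ default default) (Real.rpow_pos_of_pos hs _) (Real.exp_pos _)
  have hC₂ : 0 ≤ C₂ := nonneg_of_abs_le_mul_mul (hA' ⟨0, P.hd⟩ default default) (Real.rpow_pos_of_pos hs' _) (Real.exp_pos _)
  have hC₃ : 0 ≤ C₃ := nonneg_of_abs_le_mul_mul (hB default default) (Real.rpow_pos_of_pos hs _) (Real.exp_pos _)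
  have hC₄ : 0 ≤ C₄ :=
    nonneg_of_abs_le_mul_mul (hB' ⟨0, P.hd⟩ ⟨0, P.hd⟩ default default) (Real.rpow_pos_of_pos hs' _) (Real.exp_pos _)
  set Ksc : ℝ := C₁ * C₂ * (s ^ (1 - (P.d : ℝ)) * s' ^ (1 - (P.d : ℝ))) + C₃ * C₄ * (s ^ (2 - (P.d : ℝ)) * s' ^ (-(P.d : ℝ)))
    with hKsc
  have hKsc0 : 0 ≤ Ksc := by positivity
  -- the per-pair bound with the unsplit exponentials
  have hpair := fun x x' => abs_pairTerm_le (η := η) (τ := τ) (Gj := Gj) (Gj' := Gj') hg (A := A) (R := R)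
    (E := fun x x' => Real.exp (-(δ * s⁻¹ * (η * Site.tdist x x'))) * Real.exp (-(δ * s'⁻¹ * (η * Site.tdist x x'))))
    (ρ := fun x x' => H * (η * Site.tdist x x') * (η * Site.tdist x x') ^ α) (K := |τ| * Ksc)
    (fun μ μ' x x' => by
      have h := abs_kerC_le (τ := τ) hA hA' hB hB' μ μ' x x'
      rw [hKsc]
      refine h.trans (le_of_eq ?_)
      ring)
    (mul_nonneg (abs_nonneg _) hKsc0) (fun x x' => by positivity) hR hη.le x x'
  unfold curly2 pairSum
  refine (abs_sum_sum_le_of_termwise (K := (P.d : ℝ) * |τ| * Ksc * H * (2 / δ + 8 / δ ^ 2) * (min s s' * (min s s') ^ α))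
    fun x x' => ?_).trans (le_of_eq (by rw [hKsc]))
  refine (hpair x x').trans ?_
  set u : ℝ := η * Site.tdist x x' with hu
  have hu0 : 0 ≤ u := mul_nonneg hη.le (Nat.cast_nonneg _)
  have hw := exp_mul_weight_le hδ hs hs' hu0 hα0 hα1
  have hX : 0 ≤ η ^ (2 * P.d) * ((∑ μ : Fin P.d, |A ⟨x, μ⟩|) * ((P.d : ℝ) * (|τ| * Ksc) * H)) := by positivity
  calc η ^ (2 * P.d) * ((∑ μ : Fin P.d, |A ⟨x, μ⟩|) * ((P.d : ℝ) * (|τ| * Ksc *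
        (Real.exp (-(δ * s⁻¹ * u)) * Real.exp (-(δ * s'⁻¹ * u))) * (H * u * u ^ α))))
      = η ^ (2 * P.d) * ((∑ μ : Fin P.d, |A ⟨x, μ⟩|) * ((P.d : ℝ) * (|τ| * Ksc) * H)) *
          (Real.exp (-(δ * s⁻¹ * u)) * Real.exp (-(δ * s'⁻¹ * u)) * (u * u ^ α)) := by ring
    _ ≤ η ^ (2 * P.d) * ((∑ μ : Fin P.d, |A ⟨x, μ⟩|) * ((P.d : ℝ) * (|τ| * Ksc) * H)) *
          ((2 / δ + 8 / δ ^ 2) * (min s s' * (min s s') ^ α) *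
            (Real.exp (-(δ / 2 * s⁻¹ * u)) * Real.exp (-(δ / 2 * s'⁻¹ * u)))) := mul_le_mul_of_nonneg_left hw hX
    _ = (P.d : ℝ) * |τ| * Ksc * H * (2 / δ + 8 / δ ^ 2) * (min s s' * (min s s') ^ α) *
          (η ^ (2 * P.d) * ((∑ μ : Fin P.d, |A ⟨x, μ⟩|) *
            (Real.exp (-(δ / 2 * s⁻¹ * u)) * Real.exp (-(δ / 2 * s'⁻¹ * u))))) := by ring

/-- **The last curly bracket of (3.26), the (3.14)-type bound on the torus** (p. 440 *"analyzed as in … (3.14)"*, p. 436 (3.14): *"If φ′ is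
a leg of a propagator with an index j″, whose second leg is localized in Δ(v″), then the last supremum in (3.13) can be estimated by
O(1)(L^{j″}η)^{−d+1−α} sup exp[−δ₀(L^{j″}η)^{−1}dist(Γ_{x,x′},Δ(v″))]"* — here the leg is `A′`): as `abs_curly2_le` but with the
LOCALIZED remainder bound `|R_{μ′}(x,x′)| ≤ C₅·(u·u^α)·e^{+½δu/s″}·e^{−½δη|x−x″|₁/s″}` (the shape delivered by FILE A's `norm_rem_le_of_leg` /
p20's `norm_remFwd_le_of_leg` from a (2.11)-type two-point bound around `x″`; `C₅` absorbs `O(1)(L^{j″}η)^{−d+1−α}`), `max(s,s′) ≤ s″`: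
`|curly2| ≤ d|τ|(C₁C₂s^{1−d}s′^{1−d} + C₃C₄s^{2−d}s′^{−d})C₅(2/δ+8/δ²)(m·m^α)Σ_{x,x′}η^{2d}(Σ_μ|A_μ(x)|)e^{−½δu/s}e^{−½δu/s′}e^{−½δη|x−x″|₁/s″}`
(p20's `exp_mul_weight_le_local`). [cite: Balaban1983Higgs3, (3.26) p.440] -/
theorem abs_curly2_le_local (η : ℝ) (hη : 0 < η) {α τ C₁ C₂ C₃ C₄ C₅ δ s s' s'' : ℝ} (hα0 : 0 ≤ α) (hα1 : α ≤ 1)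
    (hC₅ : 0 ≤ C₅) (hδ : 0 < δ) (hs : 0 < s) (hs' : 0 < s') (hss : max s s' ≤ s'') (Gj Gj' : Kernel P j)
    (g : SiteField P j ℝ) (hg : ∀ x, |g x| ≤ 1) (A : VecField P j ℝ)
    (hA : ∀ (μ' : Fin P.d) (y y' : Site P j),
      |dAdjKernel η⁻¹ μ' Gj y y'| ≤ C₁ * s ^ (1 - (P.d : ℝ)) * Real.exp (-(δ * s⁻¹ * (η * Site.tdist y y'))))
    (hA' : ∀ (μ : Fin P.d) (y y' : Site P j),
      |dAdjKernel η⁻¹ μ Gj' y y'| ≤ C₂ * s' ^ (1 - (P.d : ℝ)) * Real.exp (-(δ * s'⁻¹ * (η * Site.tdist y y'))))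
    (hB : ∀ y y' : Site P j, |Gj y y'| ≤ C₃ * s ^ (2 - (P.d : ℝ)) * Real.exp (-(δ * s⁻¹ * (η * Site.tdist y y'))))
    (hB' : ∀ (μ' μ : Fin P.d) (y y' : Site P j),
      |d2Kernel η⁻¹ μ' μ Gj' y y'| ≤ C₄ * s' ^ (-(P.d : ℝ)) * Real.exp (-(δ * s'⁻¹ * (η * Site.tdist y y'))))
    (R : Fin P.d → Site P j → Site P j → ℝ) (x'' : Site P j)
    (hR : ∀ (μ' : Fin P.d) (x x' : Site P j), |R μ' x x'| ≤
      C₅ * ((η * Site.tdist x x') * (η * Site.tdist x x') ^ α) * Real.exp (δ / 2 * s''⁻¹ * (η * Site.tdist x x')) *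
        Real.exp (-(δ / 2 * s''⁻¹ * (η * Site.tdist x x'')))) :
    |curly2 η τ Gj Gj' g A R| ≤
      (P.d : ℝ) * |τ| * (C₁ * C₂ * (s ^ (1 - (P.d : ℝ)) * s' ^ (1 - (P.d : ℝ))) + C₃ * C₄ * (s ^ (2 - (P.d : ℝ)) * s' ^ (-(P.d : ℝ))))
        * C₅ * (2 / δ + 8 / δ ^ 2) * (min s s' * (min s s') ^ α) *
        ∑ x : Site P j, ∑ x' : Site P j, η ^ (2 * P.d) *
          ((∑ μ : Fin P.d, |A ⟨x, μ⟩|) *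
            (Real.exp (-(δ / 2 * s⁻¹ * (η * Site.tdist x x'))) * Real.exp (-(δ / 2 * s'⁻¹ * (η * Site.tdist x x'))) *
              Real.exp (-(δ / 2 * s''⁻¹ * (η * Site.tdist x x''))))) := by
  have hC₁ : 0 ≤ C₁ := nonneg_of_abs_le_mul_mul (hA ⟨0, P.hd⟩ default default) (Real.rpow_pos_of_pos hs _) (Real.exp_pos _)
  have hC₂ : 0 ≤ C₂ := nonneg_of_abs_le_mul_mul (hA' ⟨0, P.hd⟩ default default) (Real.rpow_pos_of_pos hs' _) (Real.exp_pos _)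
  have hC₃ : 0 ≤ C₃ := nonneg_of_abs_le_mul_mul (hB default default) (Real.rpow_pos_of_pos hs _) (Real.exp_pos _)
  have hC₄ : 0 ≤ C₄ :=
    nonneg_of_abs_le_mul_mul (hB' ⟨0, P.hd⟩ ⟨0, P.hd⟩ default default) (Real.rpow_pos_of_pos hs' _) (Real.exp_pos _)
  set Ksc : ℝ := C₁ * C₂ * (s ^ (1 - (P.d : ℝ)) * s' ^ (1 - (P.d : ℝ))) + C₃ * C₄ * (s ^ (2 - (P.d : ℝ)) * s' ^ (-(P.d : ℝ)))
    with hKsc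
  have hKsc0 : 0 ≤ Ksc := by positivity
  have hpair := fun x x' => abs_pairTerm_le (η := η) (τ := τ) (Gj := Gj) (Gj' := Gj') hg (A := A) (R := R)
    (E := fun x x' => Real.exp (-(δ * s⁻¹ * (η * Site.tdist x x'))) * Real.exp (-(δ * s'⁻¹ * (η * Site.tdist x x'))))
    (ρ := fun x x' => C₅ * ((η * Site.tdist x x') * (η * Site.tdist x x') ^ α) *
      Real.exp (δ / 2 * s''⁻¹ * (η * Site.tdist x x')) * Real.exp (-(δ / 2 * s''⁻¹ * (η * Site.tdist x x''))))
    (K := |τ| * Ksc)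
    (fun μ μ' x x' => by
      have h := abs_kerC_le (τ := τ) hA hA' hB hB' μ μ' x x'
      rw [hKsc]
      refine h.trans (le_of_eq ?_)
      ring)
    (mul_nonneg (abs_nonneg _) hKsc0) (fun x x' => by positivity) hR hη.le x x'
  unfold curly2 pairSum
  refine (abs_sum_sum_le_of_termwise (K := (P.d : ℝ) * |τ| * Ksc * C₅ * (2 / δ + 8 / δ ^ 2) * (min s s' * (min s s') ^ α))
    fun x x' => ?_).trans (le_of_eq (by rw [hKsc]))
  refine (hpair x x').trans ?_
  set u : ℝ := η * Site.tdist x x' with hu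
  set Ex : ℝ := Real.exp (-(δ / 2 * s''⁻¹ * (η * Site.tdist x x''))) with hEx
  have hu0 : 0 ≤ u := mul_nonneg hη.le (Nat.cast_nonneg _)
  have hw := exp_mul_weight_le_local hδ hs hs' hss hu0 hα0 hα1
  have hX : 0 ≤ η ^ (2 * P.d) * ((∑ μ : Fin P.d, |A ⟨x, μ⟩|) * ((P.d : ℝ) * (|τ| * Ksc) * C₅ * Ex)) := by positivity
  calc η ^ (2 * P.d) * ((∑ μ : Fin P.d, |A ⟨x, μ⟩|) * ((P.d : ℝ) * (|τ| * Ksc *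
        (Real.exp (-(δ * s⁻¹ * u)) * Real.exp (-(δ * s'⁻¹ * u))) *
          (C₅ * (u * u ^ α) * Real.exp (δ / 2 * s''⁻¹ * u) * Ex))))
      = η ^ (2 * P.d) * ((∑ μ : Fin P.d, |A ⟨x, μ⟩|) * ((P.d : ℝ) * (|τ| * Ksc) * C₅ * Ex)) *
          (Real.exp (-(δ * s⁻¹ * u)) * Real.exp (-(δ * s'⁻¹ * u)) * Real.exp (δ / 2 * s''⁻¹ * u) * (u * u ^ α)) := by ring
    _ ≤ η ^ (2 * P.d) * ((∑ μ : Fin P.d, |A ⟨x, μ⟩|) * ((P.d : ℝ) * (|τ| * Ksc) * C₅ * Ex)) *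
          ((2 / δ + 8 / δ ^ 2) * (min s s' * (min s s') ^ α) *
            (Real.exp (-(δ / 2 * s⁻¹ * u)) * Real.exp (-(δ / 2 * s'⁻¹ * u)))) := mul_le_mul_of_nonneg_left hw hX
    _ = (P.d : ℝ) * |τ| * Ksc * C₅ * (2 / δ + 8 / δ ^ 2) * (min s s' * (min s s') ^ α) *
          (η ^ (2 * P.d) * ((∑ μ : Fin P.d, |A ⟨x, μ⟩|) *
            (Real.exp (-(δ / 2 * s⁻¹ * u)) * Real.exp (-(δ / 2 * s'⁻¹ * u)) * Ex))) := by ring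

end Torus

/-! ## §1b The printed cube-localized forms on the torus and the Taylor-remainder specialization -/

section TorusCubes

variable {P : Params} {j : ℕ}

open B3Ineq314Cubes (cubeIdx cubes fiber cdist sum_sum_le_cubes exp_tdist_le_exp_cdist)

/-- **The last curly bracket of (3.26) in the printed CUBE-LOCALIZED (3.13) form on the torus** (p. 436: *"We localize additionally the
vertices in cubes Δ(v), Δ(v′), |Δ(v)| = |Δ(v′)| = (L^{j₁}η)^d, and we have (…) ≦ O(1) Σ_{Δ(v),Δ(v′)} sup_{x∈Δ(v)} … "*), PROVED for every
cube side `M ≥ 1` (print: `M = L^{j₁}`): under the hypotheses of `abs_curly2_le`,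
`|curly2| ≤ d|τ|(C₁C₂s^{1−d}s′^{1−d} + C₃C₄s^{2−d}s′^{−d})H(2/δ+8/δ²)(m·m^α)·Σ_{Δ,Δ′}(Mη)^{2d}(sup_{x∈Δ}Σ_μ|A_μ(x)|)e^{−½δη·dist(Δ,Δ′)/s}
e^{−½δη·dist(Δ,Δ′)/s′}` (p20's `sum_sum_le_cubes`). [cite: Balaban1983Higgs3, (3.26) p.440] -/
theorem abs_curly2_le_cubes (η : ℝ) (hη : 0 < η) {α H τ C₁ C₂ C₃ C₄ δ s s' : ℝ} (hα0 : 0 ≤ α) (hα1 : α ≤ 1) (hH : 0 ≤ H)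
    (hδ : 0 < δ) (hs : 0 < s) (hs' : 0 < s') (Gj Gj' : Kernel P j) (g : SiteField P j ℝ) (hg : ∀ x, |g x| ≤ 1)
    (A : VecField P j ℝ)
    (hA : ∀ (μ' : Fin P.d) (y y' : Site P j),
      |dAdjKernel η⁻¹ μ' Gj y y'| ≤ C₁ * s ^ (1 - (P.d : ℝ)) * Real.exp (-(δ * s⁻¹ * (η * Site.tdist y y'))))
    (hA' : ∀ (μ : Fin P.d) (y y' : Site P j),
      |dAdjKernel η⁻¹ μ Gj' y y'| ≤ C₂ * s' ^ (1 - (P.d : ℝ)) * Real.exp (-(δ * s'⁻¹ * (η * Site.tdist y y'))))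
    (hB : ∀ y y' : Site P j, |Gj y y'| ≤ C₃ * s ^ (2 - (P.d : ℝ)) * Real.exp (-(δ * s⁻¹ * (η * Site.tdist y y'))))
    (hB' : ∀ (μ' μ : Fin P.d) (y y' : Site P j),
      |d2Kernel η⁻¹ μ' μ Gj' y y'| ≤ C₄ * s' ^ (-(P.d : ℝ)) * Real.exp (-(δ * s'⁻¹ * (η * Site.tdist y y'))))
    (R : Fin P.d → Site P j → Site P j → ℝ)
    (hR : ∀ (μ' : Fin P.d) (x x' : Site P j), |R μ' x x'| ≤ H * (η * Site.tdist x x') * (η * Site.tdist x x') ^ α)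
    {M : ℕ} (hM : 0 < M) :
    |curly2 η τ Gj Gj' g A R| ≤
      (P.d : ℝ) * |τ| * (C₁ * C₂ * (s ^ (1 - (P.d : ℝ)) * s' ^ (1 - (P.d : ℝ))) + C₃ * C₄ * (s ^ (2 - (P.d : ℝ)) * s' ^ (-(P.d : ℝ))))
        * H * (2 / δ + 8 / δ ^ 2) * (min s s' * (min s s') ^ α) *
        ∑ c ∈ cubes P j M, ∑ c' ∈ cubes P j M, ((M : ℝ) * η) ^ (2 * P.d) *
          (supOn (fiber M c : Finset (Site P j)) (fun x => ∑ μ : Fin P.d, |A ⟨x, μ⟩|) *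
            (Real.exp (-(δ / 2 * s⁻¹ * (η * (cdist P j M M c c' : ℝ)))) *
              Real.exp (-(δ / 2 * s'⁻¹ * (η * (cdist P j M M c c' : ℝ)))))) := by
  have hpt := abs_curly2_le (τ := τ) η hη hα0 hα1 hH hδ hs hs' Gj Gj' g hg A hA hA' hB hB' R hR
  have hC₁ : 0 ≤ C₁ := nonneg_of_abs_le_mul_mul (hA ⟨0, P.hd⟩ default default) (Real.rpow_pos_of_pos hs _) (Real.exp_pos _)
  have hC₂ : 0 ≤ C₂ := nonneg_of_abs_le_mul_mul (hA' ⟨0, P.hd⟩ default default) (Real.rpow_pos_of_pos hs' _) (Real.exp_pos _)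
  have hC₃ : 0 ≤ C₃ := nonneg_of_abs_le_mul_mul (hB default default) (Real.rpow_pos_of_pos hs _) (Real.exp_pos _)
  have hC₄ : 0 ≤ C₄ :=
    nonneg_of_abs_le_mul_mul (hB' ⟨0, P.hd⟩ ⟨0, P.hd⟩ default default) (Real.rpow_pos_of_pos hs' _) (Real.exp_pos _)
  have hm : 0 < min s s' := lt_min hs hs'
  have hK : 0 ≤ (P.d : ℝ) * |τ| * (C₁ * C₂ * (s ^ (1 - (P.d : ℝ)) * s' ^ (1 - (P.d : ℝ))) +
      C₃ * C₄ * (s ^ (2 - (P.d : ℝ)) * s' ^ (-(P.d : ℝ)))) * H * (2 / δ + 8 / δ ^ 2) * (min s s' * (min s s') ^ α) := by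
    positivity
  have hloc := sum_sum_le_cubes hM hη.le (fun x => ∑ μ : Fin P.d, |A ⟨x, μ⟩|)
    (fun x => Finset.sum_nonneg fun μ _ => abs_nonneg _)
    (fun x x' => Real.exp (-(δ / 2 * s⁻¹ * (η * Site.tdist x x'))) * Real.exp (-(δ / 2 * s'⁻¹ * (η * Site.tdist x x'))))
    (fun x x' => by positivity)
    (fun c c' => Real.exp (-(δ / 2 * s⁻¹ * (η * (cdist P j M M c c' : ℝ)))) *
      Real.exp (-(δ / 2 * s'⁻¹ * (η * (cdist P j M M c c' : ℝ)))))
    (fun x x' => mul_le_mul (exp_tdist_le_exp_cdist (by positivity) hη.le M M x x')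
      (exp_tdist_le_exp_cdist (by positivity) hη.le M M x x') (by positivity) (by positivity))
  exact hpt.trans (mul_le_mul_of_nonneg_left hloc hK)

/-- **The last curly bracket of (3.26) in the printed CUBE-LOCALIZED (3.14) form on the torus**, PROVED for every pair of cube sides
`M ≥ 1` (for `Δ(v), Δ(v′)`) and `M″ ≥ 1` (for the cube `Δ(v″)` of the second leg `x″` of the propagator carrying `A′`): under the hypotheses
of `abs_curly2_le_local`, `|curly2| ≤ d|τ|(C₁C₂s^{1−d}s′^{1−d} + C₃C₄s^{2−d}s′^{−d})C₅(2/δ+8/δ²)(m·m^α)·Σ_{Δ,Δ′}(Mη)^{2d}(sup_{x∈Δ}Σ_μ|A_μ(x)|)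
e^{−½δη·dist(Δ,Δ′)/s}e^{−½δη·dist(Δ,Δ′)/s′}e^{−½δη·dist(Δ,Δ″)/s″}` — the displayed `exp[−½δ₀(L^{j″}η)^{−1}dist(Δ(v),Δ(v″))]` of (3.14).
[cite: Balaban1983Higgs3, (3.26) p.440] -/
theorem abs_curly2_le_local_cubes (η : ℝ) (hη : 0 < η) {α τ C₁ C₂ C₃ C₄ C₅ δ s s' s'' : ℝ} (hα0 : 0 ≤ α) (hα1 : α ≤ 1)
    (hC₅ : 0 ≤ C₅) (hδ : 0 < δ) (hs : 0 < s) (hs' : 0 < s') (hss : max s s' ≤ s'') (Gj Gj' : Kernel P j)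
    (g : SiteField P j ℝ) (hg : ∀ x, |g x| ≤ 1) (A : VecField P j ℝ)
    (hA : ∀ (μ' : Fin P.d) (y y' : Site P j),
      |dAdjKernel η⁻¹ μ' Gj y y'| ≤ C₁ * s ^ (1 - (P.d : ℝ)) * Real.exp (-(δ * s⁻¹ * (η * Site.tdist y y'))))
    (hA' : ∀ (μ : Fin P.d) (y y' : Site P j),
      |dAdjKernel η⁻¹ μ Gj' y y'| ≤ C₂ * s' ^ (1 - (P.d : ℝ)) * Real.exp (-(δ * s'⁻¹ * (η * Site.tdist y y'))))
    (hB : ∀ y y' : Site P j, |Gj y y'| ≤ C₃ * s ^ (2 - (P.d : ℝ)) * Real.exp (-(δ * s⁻¹ * (η * Site.tdist y y'))))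
    (hB' : ∀ (μ' μ : Fin P.d) (y y' : Site P j),
      |d2Kernel η⁻¹ μ' μ Gj' y y'| ≤ C₄ * s' ^ (-(P.d : ℝ)) * Real.exp (-(δ * s'⁻¹ * (η * Site.tdist y y'))))
    (R : Fin P.d → Site P j → Site P j → ℝ) (x'' : Site P j)
    (hR : ∀ (μ' : Fin P.d) (x x' : Site P j), |R μ' x x'| ≤
      C₅ * ((η * Site.tdist x x') * (η * Site.tdist x x') ^ α) * Real.exp (δ / 2 * s''⁻¹ * (η * Site.tdist x x')) *
        Real.exp (-(δ / 2 * s''⁻¹ * (η * Site.tdist x x''))))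
    {M M'' : ℕ} (hM : 0 < M) :
    |curly2 η τ Gj Gj' g A R| ≤
      (P.d : ℝ) * |τ| * (C₁ * C₂ * (s ^ (1 - (P.d : ℝ)) * s' ^ (1 - (P.d : ℝ))) + C₃ * C₄ * (s ^ (2 - (P.d : ℝ)) * s' ^ (-(P.d : ℝ))))
        * C₅ * (2 / δ + 8 / δ ^ 2) * (min s s' * (min s s') ^ α) *
        ∑ c ∈ cubes P j M, ∑ c' ∈ cubes P j M, ((M : ℝ) * η) ^ (2 * P.d) *
          (supOn (fiber M c : Finset (Site P j)) (fun x => ∑ μ : Fin P.d, |A ⟨x, μ⟩|) *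
            (Real.exp (-(δ / 2 * s⁻¹ * (η * (cdist P j M M c c' : ℝ)))) *
              Real.exp (-(δ / 2 * s'⁻¹ * (η * (cdist P j M M c c' : ℝ)))) *
                Real.exp (-(δ / 2 * s''⁻¹ * (η * (cdist P j M M'' c (cubeIdx M'' x'') : ℝ)))))) := by
  have hpt := abs_curly2_le_local (τ := τ) η hη hα0 hα1 hC₅ hδ hs hs' hss Gj Gj' g hg A hA hA' hB hB' R x'' hR
  have hs'' : 0 < s'' := lt_of_lt_of_le (lt_max_of_lt_left hs) hss
  have hC₁ : 0 ≤ C₁ := nonneg_of_abs_le_mul_mul (hA ⟨0, P.hd⟩ default default) (Real.rpow_pos_of_pos hs _) (Real.exp_pos _)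
  have hC₂ : 0 ≤ C₂ := nonneg_of_abs_le_mul_mul (hA' ⟨0, P.hd⟩ default default) (Real.rpow_pos_of_pos hs' _) (Real.exp_pos _)
  have hC₃ : 0 ≤ C₃ := nonneg_of_abs_le_mul_mul (hB default default) (Real.rpow_pos_of_pos hs _) (Real.exp_pos _)
  have hC₄ : 0 ≤ C₄ :=
    nonneg_of_abs_le_mul_mul (hB' ⟨0, P.hd⟩ ⟨0, P.hd⟩ default default) (Real.rpow_pos_of_pos hs' _) (Real.exp_pos _)
  have hm : 0 < min s s' := lt_min hs hs'
  have hK : 0 ≤ (P.d : ℝ) * |τ| * (C₁ * C₂ * (s ^ (1 - (P.d : ℝ)) * s' ^ (1 - (P.d : ℝ))) +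
      C₃ * C₄ * (s ^ (2 - (P.d : ℝ)) * s' ^ (-(P.d : ℝ)))) * C₅ * (2 / δ + 8 / δ ^ 2) * (min s s' * (min s s') ^ α) := by
    positivity
  have hloc := sum_sum_le_cubes hM hη.le (fun x => ∑ μ : Fin P.d, |A ⟨x, μ⟩|)
    (fun x => Finset.sum_nonneg fun μ _ => abs_nonneg _)
    (fun x x' => Real.exp (-(δ / 2 * s⁻¹ * (η * Site.tdist x x'))) * Real.exp (-(δ / 2 * s'⁻¹ * (η * Site.tdist x x'))) *
      Real.exp (-(δ / 2 * s''⁻¹ * (η * Site.tdist x x''))))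
    (fun x x' => by positivity)
    (fun c c' => Real.exp (-(δ / 2 * s⁻¹ * (η * (cdist P j M M c c' : ℝ)))) *
      Real.exp (-(δ / 2 * s'⁻¹ * (η * (cdist P j M M c c' : ℝ)))) *
        Real.exp (-(δ / 2 * s''⁻¹ * (η * (cdist P j M M'' c (cubeIdx M'' x'') : ℝ)))))
    (fun x x' => mul_le_mul (mul_le_mul (exp_tdist_le_exp_cdist (by positivity) hη.le M M x x')
      (exp_tdist_le_exp_cdist (by positivity) hη.le M M x x') (by positivity) (by positivity))
      (exp_tdist_le_exp_cdist (by positivity) hη.le M M'' x x'') (by positivity) (by positivity))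
  exact hpt.trans (mul_le_mul_of_nonneg_left hloc hK)

end TorusCubes

section TorusTaylor

variable {P : Params} {j : ℕ}

open B3Taylor310Remainder (disp remFwd taylor310_fwd norm_remFwd_le)

/-- **(3.26) on the torus with the printed Taylor data** (hypothesis-free): r15's `eq326` BY NAME with p20's forward-derivative reading of
Taylor's formula (3.10) (`B3Taylor310Remainder.taylor310_fwd`) for the leg `g′A′_{μ′}` — `dx ν x x′ = disp η⁻¹ x x′ ν` (the displacement
`x′_ν − x_ν` along `Γ_{x,x′}`), `D ν μ′ = ∂^η_ν(g′A′_{μ′})`, `R μ′ = remFwd η⁻¹ (g′A′_{μ′})` (the printed remainder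
`Σ_{b⊂Γ_{x,x′}} η((∂^ηg′A′_{μ′})(b) − (∂^ηg′A′_{μ′})((b)_x))`). [cite: Balaban1983Higgs3, (3.26) p.440] -/
theorem eq326_taylorFwd (η : ℝ) (hη : η ≠ 0) (τ : ℝ) (Gj Gj' Gj'' : Kernel P j) (g g' : SiteField P j ℝ) (A A' : VecField P j ℝ) :
    lhs326 η τ Gj Gj' Gj'' g g' A A' =
      bracket326 η τ Gj Gj' Gj'' g g' A A'
        + curly1 η τ Gj Gj' g A (fun ν x x' => disp η⁻¹ x x' ν) (fun ν μ' => pdiff η⁻¹ ν (fun y => g' y * A' ⟨y, μ'⟩))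
        + curly2 η τ Gj Gj' g A (fun μ' x x' => remFwd η⁻¹ (fun y => g' y * A' ⟨y, μ'⟩) x x') := by
  refine eq326 η τ Gj Gj' Gj'' g g' A A' _ _ _ fun μ' x x' => ?_
  have h := taylor310_fwd η⁻¹ (inv_ne_zero hη) (fun y => g' y * A' ⟨y, μ'⟩) x x'
  simp only [smul_eq_mul] at h
  linarith

/-- **The last curly bracket of (3.26) FOR THE PRINTED REMAINDER on the torus**: the (3.13)-type bound `abs_curly2_le` specialized to
`R μ′ = remFwd η⁻¹ (g′A′_{μ′})` (the remainder of `eq326_taylorFwd`) under p20's Hölder hypothesis `HolderDeriv η⁻¹ α H (g′A′_{μ′})` on the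
differentiated leg (every `μ′`) — *"The operator acting on the leg … is a differentiation of the order 1 + α"* (p. 436); the remainder bound
`‖remFwd‖ ≤ 2H·u·u^α` is p20's `norm_remFwd_le`. [cite: Balaban1983Higgs3, (3.26) p.440] -/
theorem abs_curly2_remFwd_le (η : ℝ) (hη : 0 < η) {α H τ C₁ C₂ C₃ C₄ δ s s' : ℝ} (hα0 : 0 ≤ α) (hα1 : α ≤ 1) (hH : 0 ≤ H)
    (hδ : 0 < δ) (hs : 0 < s) (hs' : 0 < s') (Gj Gj' : Kernel P j) (g g' : SiteField P j ℝ) (hg : ∀ x, |g x| ≤ 1)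
    (A A' : VecField P j ℝ)
    (hA : ∀ (μ' : Fin P.d) (y y' : Site P j),
      |dAdjKernel η⁻¹ μ' Gj y y'| ≤ C₁ * s ^ (1 - (P.d : ℝ)) * Real.exp (-(δ * s⁻¹ * (η * Site.tdist y y'))))
    (hA' : ∀ (μ : Fin P.d) (y y' : Site P j),
      |dAdjKernel η⁻¹ μ Gj' y y'| ≤ C₂ * s' ^ (1 - (P.d : ℝ)) * Real.exp (-(δ * s'⁻¹ * (η * Site.tdist y y'))))
    (hB : ∀ y y' : Site P j, |Gj y y'| ≤ C₃ * s ^ (2 - (P.d : ℝ)) * Real.exp (-(δ * s⁻¹ * (η * Site.tdist y y'))))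
    (hB' : ∀ (μ' μ : Fin P.d) (y y' : Site P j),
      |d2Kernel η⁻¹ μ' μ Gj' y y'| ≤ C₄ * s' ^ (-(P.d : ℝ)) * Real.exp (-(δ * s'⁻¹ * (η * Site.tdist y y'))))
    (hHol : ∀ μ' : Fin P.d, B3Taylor310Remainder.HolderDeriv η⁻¹ α H (fun y => g' y * A' ⟨y, μ'⟩)) :
    |curly2 η τ Gj Gj' g A (fun μ' x x' => remFwd η⁻¹ (fun y => g' y * A' ⟨y, μ'⟩) x x')| ≤
      (P.d : ℝ) * |τ| * (C₁ * C₂ * (s ^ (1 - (P.d : ℝ)) * s' ^ (1 - (P.d : ℝ))) + C₃ * C₄ * (s ^ (2 - (P.d : ℝ)) * s' ^ (-(P.d : ℝ))))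
        * (2 * H) * (2 / δ + 8 / δ ^ 2) * (min s s' * (min s s') ^ α) *
        ∑ x : Site P j, ∑ x' : Site P j, η ^ (2 * P.d) *
          ((∑ μ : Fin P.d, |A ⟨x, μ⟩|) *
            (Real.exp (-(δ / 2 * s⁻¹ * (η * Site.tdist x x'))) * Real.exp (-(δ / 2 * s'⁻¹ * (η * Site.tdist x x'))))) := by
  refine abs_curly2_le η hη hα0 hα1 (by positivity) hδ hs hs' Gj Gj' g hg A hA hA' hB hB' _ fun μ' x x' => ?_
  have h := norm_remFwd_le (inv_pos.mpr hη) hα0 hH (hHol μ') x x'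
  rw [inv_inv, Real.norm_eq_abs] at h
  linarith

end TorusTaylor

end

end Literature.MathematicalPhysics.QuantumFieldTheory.Balaban1983to89.B3Ineq326LastBracket
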